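import Literature.NumberTheory.EllipticCurves.Kato2004.IwasawaCohomologyNumberFieldCorestriction
import Literature.NumberTheory.GaloisRepresentations.ContinuousCorestrictionResNormal
import HarnessLib

/-!
# The subgroup MODEL `H¹(K_n, T_pW_K) ≅ H¹(V_n, T_pW)` of the `K_n`-cohomology and the identities
# `cor ∘ res = [K : ℚ]`, `res ∘ cor = Σ_{Gal(K_n/ℚ_n)} conj` for the Shapiro maps of Kato's Iwasawa cohomology

Topic `NumberTheory/EllipticCurves`, sub-directory `Kato2004`; fifth file of the `K`-carrier vocabulary (after the carrier
`IwasawaH1DataOver`, the restriction `resOver`, the localisation `locOver` and the corestriction `corOver`).  Seat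
`bsd-2adic-conv-1` GEN 30 (cell `pub/bsd-2adic`).  HONEST FRAMING: definitions with bodies and proved theorems only; no named
fact, no `sorry`; nothing about any curve is asserted; BSD is not advanced by this file.

With `V_n = galRange K ⊓ Γ_{ℚ_n}` (`layerGalRange`, file `…Corestriction.lean`) and `U_n = Γ_{ℚ_n}`:

* §0 generic: `coresLe_resLe` — `cor_{U/V} ∘ res_{V/U} = [U : V]` on continuous `H¹(U, X)` (the relative form of the tree's
  `cores_resSubgroup`).
* §1 `layerResHomToGalRange n : Gal(K̄/K_n) →ₜ* V_n` (`σ ↦ res σ`), the inverse of `layerCorHom n`; `layerOfGalRangeRepHom`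
  (coefficients `θ_∞`); **`layerOfGalRange n : H¹(V_n, T_pW) → H¹(K_n, T_pW_K)`**, INVERSE to `layerToGalRange n`
  (`layerOfGalRange_layerToGalRange`, `layerToGalRange_layerOfGalRange`): the `K_n`-cohomology IS the cohomology of the model
  subgroup `V_n ≤ Γ_ℚ` (Shapiro's identification at finite level, Serre I §2.5).
* §2 **`layerResOver_eq_layerOfGalRange_resLe`**: the Shapiro restriction of `…Restriction.lean` is `res_{V_n/U_n}` read through the
  model; hence **`layerCorOver_layerResOver`**: `cor_n ∘ res_n = [U_n : V_n]` on `H¹(ℚ_n, T_pW)` and, when `κ ∘ res` is onto and `K/ℚ`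
  is Galois, `[U_n : V_n] = [Γ_ℚ : galRange K]` (`index_subgroupOf_layerGalRange`; `= [K : ℚ]`, e.g. `2` by the tree's `index_galRange`);
  **`layerResOver_layerCorOver`**: `res_n ∘ cor_n = Σ_{x ∈ U_n/V_n} conj_{s(x)}` read through the model (normal-case double-coset
  formula `resLe_coresLe_eq_sum_conjMap`) — for `K` quadratic, `res ∘ cor = 1 + σ`.
* §3 on the pinned carriers: `IwasawaH1DataOver.corOver_resOver` (`cor (res x) = [Γ_ℚ : galRange K] • x` in `𝐇¹_Γ(T_pW)`) and the
  levelwise `proj_resOver_corOver`.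

References: J. Neukirch, A. Schmidt, K. Wingberg, *Cohomology of Number Fields* (2008), I §5 Prop. 1.5.3 (iv), (1.5.6)–(1.5.7)
[NeukirchSchmidtWingberg2008]; J.-P. Serre, *Galois Cohomology* (1997) I §2.4–§2.5 [SerreGaloisCohomology1997]; K. Kato, Astérisque
295 (2004) §12.2 [Kato2004Asterisque]; K. Rubin, *Euler Systems* (2000), App. B §3 [Rubin2000]; L. Washington, GTM 83 §13.1 [Washington1997].
-/

noncomputable section

open scoped NumberField Pointwise
open CategoryTheory Field IsDedekindDomain Polynomial
open Literature.NumberTheory.GaloisRepresentations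
open Literature.NumberTheory.EllipticCurves (subgroupInclusion subgroupInclusion_apply_coe
  subgroupConj subgroupConj_apply_coe tateModuleEquiv continuous_tateModuleEquiv continuous_tateModuleEquiv_symm
  tateModuleEquiv_tateGaloisRep_restrict galRange rangeToResGal resGal_rangeToResGal resGal rangeToResGal_resGalToRange)
open Literature.NumberTheory.EllipticCurves.Kato2004.CM (tateRepK integralH1K mem_integralH1K_iff)
open Literature.NumberTheory.EllipticCurves.Kato2004.EulerSystemValues (tateRep)

namespace Literature.NumberTheory.EllipticCurves.Kato2004

universe u v

/-! ## §0 Generic: `cor_{U/V} ∘ res_{V/U} = [U : V]` -/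

section Generic

variable {R : Type u} [Ring R] [TopologicalSpace R]
  {G : Type v} [Group G] [TopologicalSpace G] [IsTopologicalGroup G]

/-- **`cor ∘ res = [U : V]`** for the RELATIVE maps of subgroups `V ≤ U` (`V` open of finite index in `U`): on `H¹(U, X)`,
`cor_{U/V} (res_{V/U} c) = [U : V] • c` — the tree's absolute `cores_resSubgroup` inside `U`.
[cite: NeukirchSchmidtWingberg2008, I §5 Prop. 1.5.3 (iv)] [cite: SerreGaloisCohomology1997, I §2.4 Prop. 9] -/
theorem coresLe_resLe (X : TopRep.{v} R G) {V U : Subgroup G} (h : V ≤ U) (hV : IsOpen (V : Set G))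
    [Fintype (U ⧸ V.subgroupOf U)] (c : continuousCohomology 1 (subgroupRep X U)) :
    coresLe X h hV (resLe X h 1 c) = ((V.subgroupOf U).index : R) • c := by
  obtain ⟨φ, rfl⟩ := oneCocycleClass_surjective _ c
  have hres : toSubgroupOf X h 1 (resLe X h 1 (oneCocycleClass _ φ)) =
      resSubgroup (subgroupRep X U) (V.subgroupOf U) 1 (oneCocycleClass _ φ) := by
    rw [resLe_oneCocycleClass, toSubgroupOf, map_oneCocycleClass, resSubgroup_oneCocycleClass]
    exact congrArg _ (Subtype.ext (ContinuousMap.ext fun _ ↦ rfl))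
  rw [coresLe, LinearMap.coe_comp, Function.comp_apply, ContinuousLinearMap.coe_coe]
  change cores _ _ _ (toSubgroupOf X h 1 (resLe X h 1 (oneCocycleClass _ φ))) = _
  rw [hres, cores_resSubgroup]

end Generic

/-! ## §1 The model isomorphism `H¹(K_n, T_pW_K) ≅ H¹(V_n, T_pW)` -/

section Model

variable (K : Type) [Field K] [NumberField K] {p : ℕ} [Fact p.Prime] (κ : ZpExtension ℚ p)
  (h : Function.Surjective (κ.toContinuousMonoidHom.comp (absGaloisRestrict ℚ K)))

/-- **`Gal(K̄/K_n) →ₜ* V_n`**, `σ ↦ res σ` (the inverse identification to `layerCorHom n`). [cite: SerreGaloisCohomology1997, II §1.1] -/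
def layerResHomToGalRange (n : ℕ) : (κ.restrict K h).layerSubgroup n →ₜ* layerGalRange K κ n where
  toFun σ := ⟨absGaloisRestrict ℚ K σ, ⟨(σ : absoluteGaloisGroup K), rfl⟩, (mem_layerSubgroup_restrict_iff κ h n _).mp σ.2⟩
  map_one' := Subtype.ext (by simp)
  map_mul' a b := Subtype.ext (by simp)
  continuous_toFun := ((map_continuous (absGaloisRestrict ℚ K)).comp continuous_subtype_val).subtype_mk _

/-- Unfolding: `layerResHomToGalRange n σ = res σ` in `Γ_ℚ`. [cite: SerreGaloisCohomology1997, II §1.1] -/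
@[simp] theorem layerResHomToGalRange_apply_coe (n : ℕ) (σ : (κ.restrict K h).layerSubgroup n) :
    ((layerResHomToGalRange K κ h n σ : layerGalRange K κ n) : absoluteGaloisGroup ℚ) = absGaloisRestrict ℚ K σ := rfl

/-- `layerCorHom n ∘ layerResHomToGalRange n = id` (`rangeToResGal (res σ) = σ`). [cite: SerreGaloisCohomology1997, II §1.1] -/
@[simp] theorem layerCorHom_layerResHomToGalRange (n : ℕ) (σ : (κ.restrict K h).layerSubgroup n) :
    layerCorHom K κ h n (layerResHomToGalRange K κ h n σ) = σ :=
  Subtype.ext (rangeToResGal_resGalToRange (K := ℚ) K (σ : absoluteGaloisGroup K))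

/-- `layerResHomToGalRange n ∘ layerCorHom n = id` (`res (rangeToResGal g) = g`). [cite: SerreGaloisCohomology1997, II §1.1] -/
@[simp] theorem layerResHomToGalRange_layerCorHom (n : ℕ) (g : layerGalRange K κ n) :
    layerResHomToGalRange K κ h n (layerCorHom K κ h n g) = g :=
  Subtype.ext (absGaloisRestrict_layerCorHom K κ h n g)

/-- `layerResHom n = (V_n ≤ U_n) ∘ layerResHomToGalRange n` in `U_n`. [cite: SerreGaloisCohomology1997, II §1.1] -/
theorem subgroupInclusion_layerResHomToGalRange (n : ℕ) (σ : (κ.restrict K h).layerSubgroup n) :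
    subgroupInclusion (layerGalRange_le K κ n) (layerResHomToGalRange K κ h n σ) = layerResHom κ h n σ :=
  Subtype.ext rfl

variable (W : WeierstrassCurve ℚ) [W.IsElliptic] [ContinuousSMul ℤ_[p] (W.tateModule p)]
  [ContinuousSMul ℤ_[p] ((W.baseChange K).tateModule p)]

/-- The module half of the inverse pair: `T_pW|_{V_n}` pulled back along `layerResHomToGalRange n` maps to `T_p(W_K)|_{Γ_{K_n}}` by `θ_∞`.
[cite: NeukirchSchmidtWingberg2008, I §5 Prop. 1.5.4] -/
def layerOfGalRangeRepHom (n : ℕ) :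
    TopRep.res (layerResHomToGalRange K κ h n : (κ.restrict K h).layerSubgroup n →* layerGalRange K κ n)
        (subgroupRep (tateRep W p).toTopRep (layerGalRange K κ n)) ⟶
      subgroupRep (tateRepK (W.baseChange K) p).toTopRep ((κ.restrict K h).layerSubgroup n) :=
  TopRep.ofHom ⟨⟨(tateModuleEquiv W K p).toLinearMap, continuous_tateModuleEquiv W K p⟩, fun σ =>
    ContinuousLinearMap.ext fun v => tateModuleEquiv_toTopRep_ρ W (σ : absoluteGaloisGroup K) v⟩

/-- The coefficient map of the inverse model map is `θ_∞`. [cite: NeukirchSchmidtWingberg2008, I §5 Prop. 1.5.4 (compatible pairs)] -/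
@[simp] theorem layerOfGalRangeRepHom_hom_apply (n : ℕ) (v : W.tateModule p) :
    (layerOfGalRangeRepHom K κ h W n).hom v = tateModuleEquiv W K p v := rfl

/-- **The inverse model map `H¹(V_n, T_pW) → H¹(K_n, T_pW_K)`**: pull-back along `(layerResHomToGalRange n, θ_∞)`.
[cite: SerreGaloisCohomology1997, I §2.4] -/
def layerOfGalRange (n : ℕ) :
    H1 (tateRep W p) (layerGalRange K κ n) ⟶ H1 (tateRepK (W.baseChange K) p) ((κ.restrict K h).layerSubgroup n) :=
  ContinuousCohomology.map (layerResHomToGalRange K κ h n) (layerOfGalRangeRepHom K κ h W n) 1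

/-- `layerOfGalRange` on explicit cocycles: `[ψ] ↦ [θ_∞ ∘ ψ ∘ res]`. [cite: SerreGaloisCohomology1997, I §2.4] -/
theorem layerOfGalRange_oneCocycleClass (n : ℕ) (ψ : contOneCocycles (subgroupRep (tateRep W p).toTopRep (layerGalRange K κ n))) :
    layerOfGalRange K κ h W n (oneCocycleClass _ ψ) =
      oneCocycleClass _ (contOneCocycles.pullback (layerResHomToGalRange K κ h n) (layerOfGalRangeRepHom K κ h W n) ψ) :=
  map_oneCocycleClass _ _ _ ψ

/-- **`layerOfGalRange n ∘ layerToGalRange n = id`** on `H¹(K_n, T_pW_K)`. [cite: SerreGaloisCohomology1997, I §2.5 (Shapiro)] -/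
@[simp] theorem layerOfGalRange_layerToGalRange (n : ℕ) (y : H1 (tateRepK (W.baseChange K) p) ((κ.restrict K h).layerSubgroup n)) :
    layerOfGalRange K κ h W n (layerToGalRange K κ h W n y) = y := by
  obtain ⟨φ, rfl⟩ := oneCocycleClass_surjective _ y
  rw [layerToGalRange_oneCocycleClass, layerOfGalRange_oneCocycleClass]
  refine congrArg _ (Subtype.ext (ContinuousMap.ext fun σ ↦ ?_))
  rw [contOneCocycles.pullback_apply, contOneCocycles.pullback_apply, layerCorHom_layerResHomToGalRange,
    layerCorRepHom_hom_apply, layerOfGalRangeRepHom_hom_apply, LinearEquiv.apply_symm_apply]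

/-- **`layerToGalRange n ∘ layerOfGalRange n = id`** on `H¹(V_n, T_pW)`. [cite: SerreGaloisCohomology1997, I §2.5 (Shapiro)] -/
@[simp] theorem layerToGalRange_layerOfGalRange (n : ℕ) (c : H1 (tateRep W p) (layerGalRange K κ n)) :
    layerToGalRange K κ h W n (layerOfGalRange K κ h W n c) = c := by
  obtain ⟨ψ, rfl⟩ := oneCocycleClass_surjective _ c
  rw [layerOfGalRange_oneCocycleClass, layerToGalRange_oneCocycleClass]
  refine congrArg _ (Subtype.ext (ContinuousMap.ext fun g ↦ ?_))
  rw [contOneCocycles.pullback_apply, contOneCocycles.pullback_apply, layerResHomToGalRange_layerCorHom,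
    layerOfGalRangeRepHom_hom_apply, layerCorRepHom_hom_apply, LinearEquiv.symm_apply_apply]

/-- `layerToGalRange n` is injective. [cite: SerreGaloisCohomology1997, I §2.5 (Shapiro)] -/
theorem layerToGalRange_injective (n : ℕ) : Function.Injective (layerToGalRange K κ h W n) := fun a b hab ↦ by
  rw [← layerOfGalRange_layerToGalRange K κ h W n a, hab, layerOfGalRange_layerToGalRange]

/-- `layerOfGalRange n` is injective. [cite: SerreGaloisCohomology1997, I §2.5 (Shapiro)] -/
theorem layerOfGalRange_injective (n : ℕ) : Function.Injective (layerOfGalRange K κ h W n) := fun a b hab ↦ by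
  rw [← layerToGalRange_layerOfGalRange K κ h W n a, hab, layerToGalRange_layerOfGalRange]

/-! ## §2 `res` and `cor` through the model: `cor ∘ res = [U_n : V_n]`, `res ∘ cor = Σ conj` -/

/-- **The Shapiro restriction through the model**: `res_n = layerOfGalRange n ∘ res_{V_n/U_n}` (`res ∘ layerResHomToGalRange n = layerResHom n`,
`θ_∞ ∘ id = θ_∞`). [cite: NeukirchSchmidtWingberg2008, I §5 Prop. 1.5.4] -/
theorem layerResOver_eq_layerOfGalRange_resLe (n : ℕ) (x : H1 (tateRep W p) (κ.layerSubgroup n)) :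
    layerResOver κ h W n x = layerOfGalRange K κ h W n (resLe (tateRep W p).toTopRep (layerGalRange_le K κ n) 1 x) := by
  obtain ⟨φ, rfl⟩ := oneCocycleClass_surjective _ x
  rw [layerResOver_oneCocycleClass, resLe_oneCocycleClass, layerOfGalRange_oneCocycleClass]
  refine congrArg _ (Subtype.ext (ContinuousMap.ext fun σ ↦ ?_))
  rw [contOneCocycles.pullback_apply, contOneCocycles.pullback_apply, contOneCocycles.pullback_apply, TopRep.hom_ofHom,
    subgroupInclusion_layerResHomToGalRange, layerResRepHom_hom_apply, layerOfGalRangeRepHom_hom_apply]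
  rfl

/-- **`cor_n ∘ res_n = [U_n : V_n]`** on `H¹(ℚ_n, T_pW)`. [cite: NeukirchSchmidtWingberg2008, I §5 Prop. 1.5.3 (iv)] -/
theorem layerCorOver_layerResOver (n : ℕ) [Fintype (κ.layerSubgroup n ⧸ (layerGalRange K κ n).subgroupOf (κ.layerSubgroup n))]
    (x : H1 (tateRep W p) (κ.layerSubgroup n)) :
    layerCorOver K κ h W n (layerResOver κ h W n x) = (((layerGalRange K κ n).subgroupOf (κ.layerSubgroup n)).index : ℤ_[p]) • x := by
  rw [layerCorOver_apply, layerResOver_eq_layerOfGalRange_resLe, layerToGalRange_layerOfGalRange, coresLe_resLe]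

include h in
/-- `galRange K ⊔ Γ_{ℚ_n} = Γ_ℚ` when `κ ∘ res` is onto: every `g` is `res τ · ((res τ)⁻¹ g)` with `κ((res τ)⁻¹ g) = 1`.
[cite: Washington1997, §13.1] -/
theorem galRange_sup_layerSubgroup_eq_top (n : ℕ) : galRange (K := ℚ) K ⊔ κ.layerSubgroup n = ⊤ := by
  refine eq_top_iff.mpr fun g _ ↦ ?_
  obtain ⟨τ, hτ⟩ := h (κ g)
  have hτ' : κ (absGaloisRestrict ℚ K τ) = κ g := hτ
  have hU : (absGaloisRestrict ℚ K τ)⁻¹ * g ∈ κ.layerSubgroup n := by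
    apply κ.kerSubgroup_le_layerSubgroup n
    rw [ZpExtension.mem_kerSubgroup, map_mul, map_inv, hτ', inv_mul_cancel]
  have hg : g = absGaloisRestrict ℚ K τ * ((absGaloisRestrict ℚ K τ)⁻¹ * g) := by group
  rw [hg]
  exact Subgroup.mul_mem_sup ⟨τ, rfl⟩ hU

include h in
/-- **`[U_n : V_n] = [Γ_ℚ : galRange K]`** when `κ ∘ res` is onto and `K/ℚ` is Galois (`= [K : ℚ]`; `2` for `K` quadratic, tree `index_galRange`).
[cite: Washington1997, §13.1] -/
theorem index_subgroupOf_layerGalRange [(galRange (K := ℚ) K).Normal] (n : ℕ) :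
    ((layerGalRange K κ n).subgroupOf (κ.layerSubgroup n)).index = (galRange (K := ℚ) K).index := by
  change (galRange (K := ℚ) K ⊓ κ.layerSubgroup n).relIndex (κ.layerSubgroup n) = _
  rw [Subgroup.inf_relIndex_right, ← Subgroup.relIndex_sup_left, galRange_sup_layerSubgroup_eq_top K κ h n,
    Subgroup.relIndex_top_right]

/-- **`res_n ∘ cor_n = Σ_{x ∈ U_n/V_n} conj_{s(x)}` through the model** (for `K/ℚ` Galois), any representatives `s` of `U_n ⧸ V_n`: the normal-case
double-coset formula `resLe_coresLe_eq_sum_conjMap`.  For `K` quadratic: `res ∘ cor = 1 + σ`. [cite: NeukirchSchmidtWingberg2008, I §5 (1.5.6)–(1.5.7)] -/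
theorem layerResOver_layerCorOver [(galRange (K := ℚ) K).Normal] (n : ℕ)
    [Fintype (κ.layerSubgroup n ⧸ (layerGalRange K κ n).subgroupOf (κ.layerSubgroup n))]
    {s : κ.layerSubgroup n ⧸ (layerGalRange K κ n).subgroupOf (κ.layerSubgroup n) → κ.layerSubgroup n}
    (hs : ∀ x, (s x : κ.layerSubgroup n ⧸ (layerGalRange K κ n).subgroupOf (κ.layerSubgroup n)) = x)
    (y : H1 (tateRepK (W.baseChange K) p) ((κ.restrict K h).layerSubgroup n)) :
    layerResOver κ h W n (layerCorOver K κ h W n y) =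
      layerOfGalRange K κ h W n (haveI := normal_layerGalRange K κ n;
        ∑ x, conjMap (tateRep W p).toTopRep (layerGalRange K κ n) (s x : absoluteGaloisGroup ℚ) 1 (layerToGalRange K κ h W n y)) := by
  haveI := normal_layerGalRange K κ n
  rw [layerResOver_eq_layerOfGalRange_resLe, layerCorOver_apply, resLe_coresLe_eq_sum_conjMap _ _ _ hs]

end Model

/-! ## §3 On the pinned carriers -/

section Carriers

variable {K : Type} [Field K] [NumberField K] {p : ℕ} [Fact p.Prime] {κ : ZpExtension ℚ p}
  {h : Function.Surjective (κ.toContinuousMonoidHom.comp (absGaloisRestrict ℚ K))}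
  {W : WeierstrassCurve ℚ} [W.IsElliptic] [ContinuousSMul ℤ_[p] (W.tateModule p)]
  [ContinuousSMul ℤ_[p] ((W.baseChange K).tateModule p)]
  {γ : absoluteGaloisGroup ℚ} {γK : absoluteGaloisGroup K}
  (IK : IwasawaH1DataOver (W.baseChange K) p (κ.restrict K h) γK) (I : IwasawaH1Data W p κ γ)

namespace IwasawaH1DataOver

/-- **`cor ∘ res = [Γ_ℚ : galRange K]` on `𝐇¹_Γ(T_pW)`** (for `K/ℚ` Galois; `= [K:ℚ]`, i.e. `2` for the quadratic field of a Greenberg twist).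
[cite: NeukirchSchmidtWingberg2008, I §5 Prop. 1.5.3 (iv)] [cite: Rubin2000, App. B §3] -/
theorem corOver_resOver [(galRange (K := ℚ) K).Normal] (hγ : κ.IsTopGenerator γ) (hγK : (κ.restrict K h).IsTopGenerator γK) (x : I.H) :
    IK.corOver I hγK hγ (I.resOver IK hγ hγK x) = (galRange (K := ℚ) K).index • x := by
  refine I.ext_of_proj fun n ↦ ?_
  haveI := finite_quotient_layerGalRange K κ n
  letI : Fintype (κ.layerSubgroup n ⧸ (layerGalRange K κ n).subgroupOf (κ.layerSubgroup n)) := Fintype.ofFinite _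
  rw [proj_corOver, IwasawaH1Data.proj_resOver, layerCorOver_layerResOver, index_subgroupOf_layerGalRange K κ h n, map_nsmul,
    Nat.cast_smul_eq_nsmul]

/-- **`res ∘ cor` levelwise**: `proj n (res (cor x)) = layerOfGalRange n (Σ_{x' ∈ U_n/V_n} conj_{s(x')} (layerToGalRange n (proj n x)))` (for `K/ℚ` Galois).
[cite: NeukirchSchmidtWingberg2008, I §5 (1.5.6)–(1.5.7)] -/
theorem proj_resOver_corOver [(galRange (K := ℚ) K).Normal] (hγ : κ.IsTopGenerator γ) (hγK : (κ.restrict K h).IsTopGenerator γK) (n : ℕ)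
    [Fintype (κ.layerSubgroup n ⧸ (layerGalRange K κ n).subgroupOf (κ.layerSubgroup n))]
    {s : κ.layerSubgroup n ⧸ (layerGalRange K κ n).subgroupOf (κ.layerSubgroup n) → κ.layerSubgroup n}
    (hs : ∀ x, (s x : κ.layerSubgroup n ⧸ (layerGalRange K κ n).subgroupOf (κ.layerSubgroup n)) = x) (x : IK.H) :
    IK.proj n (I.resOver IK hγ hγK (IK.corOver I hγK hγ x)) =
      layerOfGalRange K κ h W n (haveI := normal_layerGalRange K κ n;
        ∑ x', conjMap (tateRep W p).toTopRep (layerGalRange K κ n) (s x' : absoluteGaloisGroup ℚ) 1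
          (layerToGalRange K κ h W n (IK.proj n x))) := by
  rw [IwasawaH1Data.proj_resOver, proj_corOver, layerResOver_layerCorOver K κ h W n hs]

end IwasawaH1DataOver

end Carriers

end Literature.NumberTheory.EllipticCurves.Kato2004

end
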